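import Mathlib
import Literature.Computability.AlgebraicComplexity.SimultaneousDoubleProduct

/-!
Sketch file for crux-ideate stmt-MatrixMultiplication-14308 (PrimeTwoFamilies), ideator 2.
First-lemma signatures of the idea cards; proofs are NOT claimed (sorry).
-/

namespace Summit.MatrixMultiplication.MatrixMultiplication.Cruxes.PrimeTwoFamilies.Sketch

open Finset
open scoped BigOperators Pointwise

/-! ## Card `ordered-ladder-lift` -/

/-- An ORDERED ESCAPE LADDER with `r` classes in an additive abelian group `K`:
(i) every class `(X c, Y c)` is direct (`X c ⊕ Y c`), and
(ii) for classes `p < q`, every LOWER cross difference `y' - x'` (`x' ∈ X p`, `y' ∈ Y q`) avoids every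
diagonal difference `y - x` (`x ∈ X c`, `y ∈ Y c`), for every `c`.
CKSU 2005 Prop. 4.5 (= arXiv Prop. 24) is the case `r = 2`, `K = ℤ/m`, classes `({0}, Kˣ) < (Kˣ, {0})`. -/
def IsLadder {K : Type*} [AddCommGroup K] {r : ℕ} (X Y : Fin r → Finset K) : Prop :=
  (∀ c : Fin r, ∀ x ∈ X c, ∀ x' ∈ X c, ∀ y ∈ Y c, ∀ y' ∈ Y c,
      (x - x') + (y - y') = 0 → x = x' ∧ y = y') ∧
  (∀ c p q : Fin r, p < q → ∀ x ∈ X c, ∀ y ∈ Y c, ∀ x' ∈ X p, ∀ y' ∈ Y q, y - x ≠ y' - x')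

/-- Constant-sum index words over the alphabet `Fin r` (the index code of the lift; for `r = 2` these
are the constant-weight words of CKSU Prop. 4.5). -/
def Words (r L S : ℕ) : Finset (Fin L → Fin r) :=
  Finset.univ.filter (fun w => ∑ t, ((w t : ℕ)) = S)

/-- FIRST LEMMA (lift): a ladder alphabet in `K` gives, for every length `L` and digit sum `S`, an SDPP
family in `Fin L → K` indexed by the constant-sum words, with `A w = ∏ₜ X (w t)`, `B w = ∏ₜ Y (w t)`
(clauses (W),(X) of CKSU Def. 4.1 written out exactly as in the route items, indexed by the Finset of
words instead of `Fin n`). -/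
theorem sdpp_of_ladder {K : Type*} [AddCommGroup K] [DecidableEq K] {r : ℕ}
    (X Y : Fin r → Finset K) (h : IsLadder X Y) (L S : ℕ) :
    (∀ w ∈ Words r L S,
      ∀ a ∈ Fintype.piFinset (fun t => X (w t)), ∀ a' ∈ Fintype.piFinset (fun t => X (w t)),
      ∀ b ∈ Fintype.piFinset (fun t => Y (w t)), ∀ b' ∈ Fintype.piFinset (fun t => Y (w t)),
        (a - a') + (b - b') = 0 → a = a' ∧ b = b') ∧
    (∀ i ∈ Words r L S, ∀ j ∈ Words r L S, ∀ k ∈ Words r L S,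
      ∀ a ∈ Fintype.piFinset (fun t => X (i t)), ∀ a' ∈ Fintype.piFinset (fun t => X (j t)),
      ∀ b ∈ Fintype.piFinset (fun t => Y (j t)), ∀ b' ∈ Fintype.piFinset (fun t => Y (k t)),
        (a - a') + (b - b') = 0 → i = k) := by
  sorry

/-- LADDER CONJECTURE (the transfer target C⁺, cyclic form): for every `ε > 0` there are arbitrarily
large `m` and a ladder in `ZMod m` with `r ≥ m^(1/2-ε)` classes, each of co-volume
`|X c| * |Y c| ≥ m^(1-ε)`. -/
def CyclicLadderConjecture : Prop :=
  ∀ ε : ℝ, 0 < ε → ∀ m₀ : ℕ, ∃ m ≥ m₀, ∃ r : ℕ, ∃ X Y : Fin r → Finset (ZMod m),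
    IsLadder X Y ∧ (m : ℝ) ^ (1 / 2 - ε) ≤ (r : ℝ) ∧
    ∀ c : Fin r, (m : ℝ) ^ (1 - ε) ≤ (((X c).card * (Y c).card : ℕ) : ℝ)

/-- The r = 3 two-digit alphabet in `ZMod (M*M)` (verified numerically for M ≤ 5 in
scratch/ladder_check.py): classes `({0}, G) < (low nonzero digits, high nonzero digits) < (-G, {0})`
with `G = {x : x₀ ≠ 0, x₁ ≠ M-1}`.  Stated for M = 4 so that `decide`-style checking is plausible. -/
theorem twoDigitLadder_sixteen :
    IsLadder (K := ZMod 16) (r := 3)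
      ![{0}, {1, 2, 3}, {5, 6, 7, 9, 10, 11, 13, 14, 15}]
      ![{1, 2, 3, 5, 6, 7, 9, 10, 11}, {4, 8, 12}, {0}] := by
  unfold IsLadder; refine ⟨?_, ?_⟩ <;> decide

/-! ## Card `sperner-separation-capacity` (general separation digraphs; folded into card 1 as a remark) -/

/-- The SEPARATION DIGRAPH of an alphabet: `q ⟶ p` iff every cross difference `Y q - X p` escapes
all diagonal differences.  A ladder is an alphabet whose separation digraph contains the transitive
tournament `q > p`. -/
def Separates {K : Type*} [AddCommGroup K] {r : ℕ} (X Y : Fin r → Finset K) (q p : Fin r) : Prop :=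
  ∀ c : Fin r, ∀ x ∈ X c, ∀ y ∈ Y c, ∀ x' ∈ X p, ∀ y' ∈ Y q, y - x ≠ y' - x'

/-- A Sperner family for the digraph: every ordered pair of distinct words is separated somewhere. -/
def IsSpernerFamily {r L : ℕ} (G : Fin r → Fin r → Prop) (F : Finset (Fin L → Fin r)) : Prop :=
  ∀ Q ∈ F, ∀ R ∈ F, Q ≠ R → ∃ t : Fin L, G (Q t) (R t)


/-! ## Zone theorem for alphabets: the FRAME CAP (Lovász 1977, skew Bollobás for subspaces) -/

/-- **Frame cap.** A *linear frame ladder* with `r` classes in `F^{2l}`: complementary pairs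
`(V c, W c)` of `l`-dimensional subspaces (the linear reason for directness of `A c ⊂ V c`, `B c ⊂ W c`)
such that for `p < q` the CROSS pair does not span (`V p ⊔ W q ≠ ⊤`, the linear certificate that
`B q - A p` lies in a proper coset which punctured diagonal differences can avoid).  Lovász's skew
Bollobás theorem for subspaces (applied to `(V c)ᗮ`, `(W c)ᗮ` in the dual) gives `r ≤ C(2l, l)`:
CKSU Prop. 4.5 (coordinate frames, `r = C(2l,l)`) is EXTREMAL among linear frames, one-directionally.
Consequently frame alphabets have `θ = log r / log |K| ≤ log 2 / log q → 0`: they can never reach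
`θ → 1/2`; near-apex alphabets must certify separation by VALUE patterns inside spanning cross pairs. -/
theorem frameCap {F : Type*} [Field F] {l r : ℕ}
    (V W : Fin r → Submodule F (Fin (2 * l) → F))
    (hdimV : ∀ c, Module.finrank F (V c) = l) (hdimW : ∀ c, Module.finrank F (W c) = l)
    (hdiag : ∀ c, V c ⊓ W c = ⊥)
    (hcross : ∀ p q : Fin r, p < q → V p ⊔ W q ≠ ⊤) :
    r ≤ (2 * l).choose l := by
  sorry

end Summit.MatrixMultiplication.MatrixMultiplication.Cruxes.PrimeTwoFamilies.Sketch
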